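import Mathlib.Algebra.MvPolynomial.PDeriv
import Mathlib.RingTheory.MvPolynomial.Ideal
import Mathlib.RingTheory.Ideal.Operations
import Mathlib.Data.ZMod.Basic
import HarnessLib

/-!
# Crux `Steer` (stmt-ResolutionOfSingularities-16345), kill test K4.1d / object U9: kernel twin of the smallest NOEXIT specimen
# «0401;4030», `t² = y₁⁴y₃ + y₀⁴y₂³` at `p = 2` — the period-2 σ_top-steered run, its charts, Jacobian ideals, permissibility and
# order facts as ring-level theorems

OURS (campaign `res-hironaka`, rung L ★L-G4, slot W4.1; seat `res-L1-s11-pv-1` g2, object W4.1 U9 «NOEXIT SPECIMEN AUTOPSY» of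
res-L0-w41-plan-1 CUT/RULING 56 (a) / RULING 62; PREREG-U9 f07b5af3df549a66; kit job j275592). Theses-free, definition-free helper
`--supports stmt-ResolutionOfSingularities-16345 --as helper`; replaces the role of no printed item; NOT a statement of the manuscript under
review [claim: Hironaka2017, status: under-review]; AI-produced, which is weaker than expert review. Nothing here is progress on resolution of
singularities in characteristic `p`; it certifies elementary polynomial facts about ONE explicit radicand.

**The datum (res-L0-repro-1 j271169 = K4.1d job D, smallest NOEXIT radicand on the lacunary primary valuations V-BA / V-AC; RULING 55b).**
Regular parameters `u₀,u₁,u₂,u₃` (letters `X 0 … X 3`), radicand `F = u₁⁴u₃ + u₀⁴u₂³` («even» stages) and `F′ = u₀⁴u₂ + u₁⁴u₂²u₃` («odd»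
stages). The machine run (K4.1d engine v1; U9 replays it) is: at an even stage the singular locus of `t² = F` is `V(u₂,u₁) ∪ V(u₁,u₀)`,
σ_top may take either regular top component, the NOEXIT branch takes `(u₂,u₁)` with exceptional parameter `u₂` (`v(u₂) = (0,2) < v(u₁)`),
`u₁ = u₂u₁′`, and `F ↦ u₂²·F′`; at an odd stage the singular locus of `t² = F′` is `V(u₂,u₀) ∪ V(u₁,u₀)`, the branch takes `(u₂,u₀)`,
`u₀ = u₂u₀′`, and `F′ ↦ u₂²·F` — the SAME `F`: period 2, substitution `S₂ : u₀ ↦ u₀u₂, u₁ ↦ u₁u₂` with `F ∘ S₂ = u₂⁴·F`.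

## What is proved (all `sorry`-free; `ring` identities over any commutative ring, ideal facts over any commutative ring, derivatives over
## any commutative ring of characteristic 2)
* § 1 charts: `step_even`, `step_odd`, `period_two` (and the other σ_top branch `step_even_bigPlane` for comparison);
* § 2 Jacobian ideals in characteristic 2: `∂₀F = ∂₁F = 0`, `∂₂F = u₀⁴u₂²`, `∂₃F = u₁⁴`; `∂₂F′ = u₀⁴`, `∂₃F′ = u₁⁴u₂²`, `∂₀F′ = ∂₁F′ = 0`;
  hence `J(F) = (u₀⁴u₂², u₁⁴) ≤ (u₂,u₁) ⊓ (u₁,u₀)` and `(u₁, u₀u₂) ≤ √J(F)` (so `V(J(F)) = V(u₂,u₁) ∪ V(u₁,u₀)` set-theoretically), and the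
  analogous sandwich for `F′` with `(u₂,u₀)`, `(u₁,u₀)`;
* § 3 permissibility ingredients: `F ∈ (u₂,u₁)²`, `F ∈ (u₁,u₀)²`, `F′ ∈ (u₂,u₀)²`, `F′ ∈ (u₁,u₀)²` (order ≥ 2 = the multiplicity along every
  top component: equimultiple, Hironaka-permissible centres; the centres are coordinate planes, hence regular);
* § 4 HIGH: `F, F′ ∈ 𝔪⁵ ∖ 𝔪⁶` (`𝔪 = (u₀,…,u₃)`; cleaned order 5 at every stage since neither has a square-class monomial);
* § 5 boundary parity: `u₂ ∣ F′`, `¬ u₂² ∣ F′` (the fresh exceptional divisor `V(u₂)` has ODD multiplicity 1 in `F′`) and `¬ u₂ ∣ F`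
  (multiplicity 0 in `F`) — the residual-order bookkeeping `d = 5 / 4` of PREREG-FB D·S3 read on this run;
* § 6 values: the lex bookkeeping `(a, b − 2) > (0, 2)` whenever `a > 0` — the comparison that keeps `u₂` the exceptional parameter for ever.
The σ_top LEGALITY itself (minimal primes of `J`, regularity) is the engine's / U9's exact computation; § 2–§ 3 are its ring-level ingredients.
-/

-- `Summit.<S>.<S>.…` duplicates the summit name by design (single-problem summit).
set_option linter.dupNamespace false

open MvPolynomial

namespace Summit.ResolutionOfSingularities.ResolutionOfSingularities.Theorems.K41dNoExitSpecimen

/-! ## § 1 Charts as ring identities (any commutative ring) -/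

section Charts

variable {A : Type*} [CommRing A]

/-- Even stage, NOEXIT branch: blow up `(u₂,u₁)`, chart `u₁ = u₂·u₁′` (exceptional parameter `u₂`):
`F(u₀, u₂u₁′, u₂, u₃) = u₂²·F′(u₀,u₁′,u₂,u₃)` with `F′ = u₀⁴u₂ + u₁′⁴u₂²u₃`. [folklore] -/
theorem step_even (u0 u1 u2 u3 : A) :
    (u2 * u1) ^ 4 * u3 + u0 ^ 4 * u2 ^ 3 = u2 ^ 2 * (u0 ^ 4 * u2 + u1 ^ 4 * u2 ^ 2 * u3) := by ring

/-- Odd stage, NOEXIT branch: blow up `(u₂,u₀)`, chart `u₀ = u₂·u₀′`: `F′(u₂u₀′, u₁, u₂, u₃) = u₂²·F(u₀′,u₁,u₂,u₃)` — the even radicand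
RETURNS. [folklore] -/
theorem step_odd (u0 u1 u2 u3 : A) :
    (u2 * u0) ^ 4 * u2 + u1 ^ 4 * u2 ^ 2 * u3 = u2 ^ 2 * (u1 ^ 4 * u3 + u0 ^ 4 * u2 ^ 3) := by ring

/-- **Period two.** The composite substitution `S₂ : u₀ ↦ u₀u₂, u₁ ↦ u₁u₂` (two σ_top centre steps with the same exceptional parameter
`u₂`) multiplies the radicand by the square `u₂⁴`: `F ∘ S₂ = u₂⁴·F`, i.e. `t ↦ t/u₂²` restores `t² = F` verbatim. [folklore] -/
theorem period_two (u0 u1 u2 u3 : A) :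
    (u1 * u2) ^ 4 * u3 + (u0 * u2) ^ 4 * u2 ^ 3 = u2 ^ 4 * (u1 ^ 4 * u3 + u0 ^ 4 * u2 ^ 3) := by ring

/-- The OTHER σ_top branch at an even stage (the «big» plane `(u₁,u₀)`, exceptional parameter `u₀` since `v(u₀) < v(u₁)`): chart
`u₁ = u₀·u₁′` gives `F = u₀⁴·(u₁′⁴u₃ + u₂³)`; the radicand `u₁′⁴u₃ + u₂³` is singular exactly along the divisor `V(u₂)` … and the
machine words of these branches END with `E` (exit) — recorded by U9, not proved here. [folklore] -/
theorem step_even_bigPlane (u0 u1 u2 u3 : A) :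
    (u0 * u1) ^ 4 * u3 + u0 ^ 4 * u2 ^ 3 = u0 ^ 4 * (u1 ^ 4 * u3 + u2 ^ 3) := by ring

end Charts

/-! ## § 2 Jacobian ideals in characteristic `2` -/

section Jacobian

variable {R : Type*} [CommRing R]

/-- `2 = 0` in `R[u]` for `R` of characteristic `2`. -/
private theorem two_eq_zero' [CharP R 2] : (2 : MvPolynomial (Fin 4) R) = 0 := by
  have h : (2 : R) = 0 := by simpa using CharP.cast_eq_zero R 2
  rw [show (2 : MvPolynomial (Fin 4) R) = C (2 : R) from (map_ofNat C 2).symm, h, C_0]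

/-- `4 = 0` in `R[u]` for `R` of characteristic `2`. -/
private theorem four_eq_zero' [CharP R 2] : (4 : MvPolynomial (Fin 4) R) = 0 := by
  rw [show (4 : MvPolynomial (Fin 4) R) = 2 * 2 by norm_num, two_eq_zero', mul_zero]

/-- `3 = 1` in `R[u]` for `R` of characteristic `2`. -/
private theorem three_eq_one' [CharP R 2] : (3 : MvPolynomial (Fin 4) R) = 1 := by
  rw [show (3 : MvPolynomial (Fin 4) R) = 2 + 1 by norm_num, two_eq_zero', zero_add]

/-- `∂₀F = 4u₀³u₂³ = 0` in characteristic `2`. [folklore] -/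
theorem pderiv0_F [CharP R 2] : pderiv 0 (X 1 ^ 4 * X 3 + X 0 ^ 4 * X 2 ^ 3 : MvPolynomial (Fin 4) R) = 0 := by
  simp [Derivation.leibniz_pow, Derivation.leibniz, pderiv_X, four_eq_zero']

/-- `∂₁F = 4u₁³u₃ = 0` in characteristic `2`. [folklore] -/
theorem pderiv1_F [CharP R 2] : pderiv 1 (X 1 ^ 4 * X 3 + X 0 ^ 4 * X 2 ^ 3 : MvPolynomial (Fin 4) R) = 0 := by
  simp [Derivation.leibniz_pow, Derivation.leibniz, pderiv_X, four_eq_zero']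

/-- `∂₂F = 3u₀⁴u₂² = u₀⁴u₂²` in characteristic `2`. [folklore] -/
theorem pderiv2_F [CharP R 2] : pderiv 2 (X 1 ^ 4 * X 3 + X 0 ^ 4 * X 2 ^ 3 : MvPolynomial (Fin 4) R) = X 0 ^ 4 * X 2 ^ 2 := by
  simp [Derivation.leibniz_pow, Derivation.leibniz, pderiv_X, three_eq_one']

/-- `∂₃F = u₁⁴`. [folklore] -/
theorem pderiv3_F : pderiv 3 (X 1 ^ 4 * X 3 + X 0 ^ 4 * X 2 ^ 3 : MvPolynomial (Fin 4) R) = X 1 ^ 4 := by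
  simp [Derivation.leibniz_pow, Derivation.leibniz, pderiv_X]

/-- `∂₀F′ = 0`, `∂₁F′ = 0` in characteristic `2`. [folklore] -/
theorem pderiv01_F' [CharP R 2] :
    pderiv 0 (X 0 ^ 4 * X 2 + X 1 ^ 4 * X 2 ^ 2 * X 3 : MvPolynomial (Fin 4) R) = 0 ∧
      pderiv 1 (X 0 ^ 4 * X 2 + X 1 ^ 4 * X 2 ^ 2 * X 3 : MvPolynomial (Fin 4) R) = 0 := by
  constructor <;> simp [Derivation.leibniz_pow, Derivation.leibniz, pderiv_X, four_eq_zero']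

/-- `∂₂F′ = u₀⁴ + 2u₁⁴u₂u₃ = u₀⁴` in characteristic `2`. [folklore] -/
theorem pderiv2_F' [CharP R 2] : pderiv 2 (X 0 ^ 4 * X 2 + X 1 ^ 4 * X 2 ^ 2 * X 3 : MvPolynomial (Fin 4) R) = X 0 ^ 4 := by
  simp [Derivation.leibniz_pow, Derivation.leibniz, pderiv_X, two_eq_zero']

/-- `∂₃F′ = u₁⁴u₂²`. [folklore] -/
theorem pderiv3_F' : pderiv 3 (X 0 ^ 4 * X 2 + X 1 ^ 4 * X 2 ^ 2 * X 3 : MvPolynomial (Fin 4) R) = X 1 ^ 4 * X 2 ^ 2 := by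
  simp [Derivation.leibniz_pow, Derivation.leibniz, pderiv_X]

/-- (even stages) the Jacobian ideal `J(F) = (u₀⁴u₂², u₁⁴)` lies in BOTH coordinate planes `(u₂,u₁)` and `(u₁,u₀)`:
both planes are singular for `t² = F` (Jacobian criterion at `p = 2`: `∂t(t²) = 0`). [folklore] -/
theorem jacobian_F_le :
    Ideal.span {(X 0 ^ 4 * X 2 ^ 2 : MvPolynomial (Fin 4) R), X 1 ^ 4} ≤
      Ideal.span {(X 2 : MvPolynomial (Fin 4) R), X 1} ⊓ Ideal.span {(X 1 : MvPolynomial (Fin 4) R), X 0} := by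
  rw [Ideal.span_le]
  rintro g hg
  simp only [Set.mem_insert_iff, Set.mem_singleton_iff] at hg
  have h2 : (X 2 : MvPolynomial (Fin 4) R) ∈ Ideal.span {(X 2 : MvPolynomial (Fin 4) R), X 1} := Ideal.subset_span (by simp)
  have h1a : (X 1 : MvPolynomial (Fin 4) R) ∈ Ideal.span {(X 2 : MvPolynomial (Fin 4) R), X 1} := Ideal.subset_span (by simp)
  have h1b : (X 1 : MvPolynomial (Fin 4) R) ∈ Ideal.span {(X 1 : MvPolynomial (Fin 4) R), X 0} := Ideal.subset_span (by simp)
  have h0 : (X 0 : MvPolynomial (Fin 4) R) ∈ Ideal.span {(X 1 : MvPolynomial (Fin 4) R), X 0} := Ideal.subset_span (by simp)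
  rcases hg with rfl | rfl
  · refine ⟨?_, ?_⟩
    · have e : (X 0 ^ 4 * X 2 ^ 2 : MvPolynomial (Fin 4) R) = (X 0 ^ 4 * X 2) * X 2 := by ring
      rw [SetLike.mem_coe, e]; exact Ideal.mul_mem_left _ _ h2
    · have e : (X 0 ^ 4 * X 2 ^ 2 : MvPolynomial (Fin 4) R) = (X 0 ^ 3 * X 2 ^ 2) * X 0 := by ring
      rw [SetLike.mem_coe, e]; exact Ideal.mul_mem_left _ _ h0
  · refine ⟨?_, ?_⟩
    · have e : (X 1 ^ 4 : MvPolynomial (Fin 4) R) = X 1 ^ 3 * X 1 := by ring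
      rw [SetLike.mem_coe, e]; exact Ideal.mul_mem_left _ _ h1a
    · have e : (X 1 ^ 4 : MvPolynomial (Fin 4) R) = X 1 ^ 3 * X 1 := by ring
      rw [SetLike.mem_coe, e]; exact Ideal.mul_mem_left _ _ h1b

/-- (even stages) conversely `u₁` and `u₀u₂` lie in `√J(F)`: `V(J(F)) ⊆ V(u₁, u₀u₂) = V(u₂,u₁) ∪ V(u₁,u₀)`; with `jacobian_F_le`
the singular locus of `t² = F` is EXACTLY the union of the two coordinate planes (both of dimension 2: top-dimensional, regular). [folklore] -/
theorem radical_jacobian_F_ge :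
    Ideal.span {(X 1 : MvPolynomial (Fin 4) R), X 0 * X 2} ≤
      (Ideal.span {(X 0 ^ 4 * X 2 ^ 2 : MvPolynomial (Fin 4) R), X 1 ^ 4}).radical := by
  set J : Ideal (MvPolynomial (Fin 4) R) := Ideal.span {(X 0 ^ 4 * X 2 ^ 2 : MvPolynomial (Fin 4) R), X 1 ^ 4}
  have ha : (X 0 ^ 4 * X 2 ^ 2 : MvPolynomial (Fin 4) R) ∈ J := Ideal.subset_span (by simp)
  have hb : (X 1 ^ 4 : MvPolynomial (Fin 4) R) ∈ J := Ideal.subset_span (by simp)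
  rw [Ideal.span_le]
  rintro g hg
  simp only [Set.mem_insert_iff, Set.mem_singleton_iff] at hg
  rcases hg with rfl | rfl
  · exact ⟨4, hb⟩
  · refine ⟨4, ?_⟩
    have e : ((X 0 * X 2) ^ 4 : MvPolynomial (Fin 4) R) = (X 0 ^ 4 * X 2 ^ 2) * X 2 ^ 2 := by ring
    rw [e]; exact Ideal.mul_mem_right _ _ ha

/-- (odd stages) `J(F′) = (u₀⁴, u₁⁴u₂²)` lies in both planes `(u₂,u₀)` and `(u₁,u₀)`. [folklore] -/
theorem jacobian_F'_le :
    Ideal.span {(X 0 ^ 4 : MvPolynomial (Fin 4) R), X 1 ^ 4 * X 2 ^ 2} ≤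
      Ideal.span {(X 2 : MvPolynomial (Fin 4) R), X 0} ⊓ Ideal.span {(X 1 : MvPolynomial (Fin 4) R), X 0} := by
  rw [Ideal.span_le]
  rintro g hg
  simp only [Set.mem_insert_iff, Set.mem_singleton_iff] at hg
  have h2 : (X 2 : MvPolynomial (Fin 4) R) ∈ Ideal.span {(X 2 : MvPolynomial (Fin 4) R), X 0} := Ideal.subset_span (by simp)
  have h0a : (X 0 : MvPolynomial (Fin 4) R) ∈ Ideal.span {(X 2 : MvPolynomial (Fin 4) R), X 0} := Ideal.subset_span (by simp)
  have h1 : (X 1 : MvPolynomial (Fin 4) R) ∈ Ideal.span {(X 1 : MvPolynomial (Fin 4) R), X 0} := Ideal.subset_span (by simp)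
  have h0b : (X 0 : MvPolynomial (Fin 4) R) ∈ Ideal.span {(X 1 : MvPolynomial (Fin 4) R), X 0} := Ideal.subset_span (by simp)
  rcases hg with rfl | rfl
  · have e : (X 0 ^ 4 : MvPolynomial (Fin 4) R) = X 0 ^ 3 * X 0 := by ring
    refine ⟨?_, ?_⟩
    · rw [SetLike.mem_coe, e]; exact Ideal.mul_mem_left _ _ h0a
    · rw [SetLike.mem_coe, e]; exact Ideal.mul_mem_left _ _ h0b
  · refine ⟨?_, ?_⟩
    · have e : (X 1 ^ 4 * X 2 ^ 2 : MvPolynomial (Fin 4) R) = (X 1 ^ 4 * X 2) * X 2 := by ring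
      rw [SetLike.mem_coe, e]; exact Ideal.mul_mem_left _ _ h2
    · have e : (X 1 ^ 4 * X 2 ^ 2 : MvPolynomial (Fin 4) R) = (X 1 ^ 3 * X 2 ^ 2) * X 1 := by ring
      rw [SetLike.mem_coe, e]; exact Ideal.mul_mem_left _ _ h1

/-- (odd stages) `u₀` and `u₁u₂` lie in `√J(F′)`: `V(J(F′)) = V(u₂,u₀) ∪ V(u₁,u₀)`. [folklore] -/
theorem radical_jacobian_F'_ge :
    Ideal.span {(X 0 : MvPolynomial (Fin 4) R), X 1 * X 2} ≤
      (Ideal.span {(X 0 ^ 4 : MvPolynomial (Fin 4) R), X 1 ^ 4 * X 2 ^ 2}).radical := by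
  set J : Ideal (MvPolynomial (Fin 4) R) := Ideal.span {(X 0 ^ 4 : MvPolynomial (Fin 4) R), X 1 ^ 4 * X 2 ^ 2}
  have ha : (X 0 ^ 4 : MvPolynomial (Fin 4) R) ∈ J := Ideal.subset_span (by simp)
  have hb : (X 1 ^ 4 * X 2 ^ 2 : MvPolynomial (Fin 4) R) ∈ J := Ideal.subset_span (by simp)
  rw [Ideal.span_le]
  rintro g hg
  simp only [Set.mem_insert_iff, Set.mem_singleton_iff] at hg
  rcases hg with rfl | rfl
  · exact ⟨4, ha⟩
  · refine ⟨4, ?_⟩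
    have e : ((X 1 * X 2) ^ 4 : MvPolynomial (Fin 4) R) = (X 1 ^ 4 * X 2 ^ 2) * X 2 ^ 2 := by ring
    rw [e]; exact Ideal.mul_mem_right _ _ hb

end Jacobian

/-! ## § 3 Permissibility ingredients: order `≥ 2` along every top component (any commutative ring) -/

section Permissible

variable {R : Type*} [CommRing R]

/-- both generators lie in `Ideal.span {a, b}`. -/
private theorem memI {a b : MvPolynomial (Fin 4) R} : a ∈ Ideal.span {a, b} ∧ b ∈ Ideal.span {a, b} :=
  ⟨Ideal.subset_span (by simp), Ideal.subset_span (by simp)⟩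

/-- `a·(a·c) ∈ I²` for `a ∈ I`. -/
private theorem mul_mul_mem_sq {I : Ideal (MvPolynomial (Fin 4) R)} {a c : MvPolynomial (Fin 4) R} (ha : a ∈ I) :
    a * (a * c) ∈ I ^ 2 := by
  rw [pow_two]; exact Ideal.mul_mem_mul ha (Ideal.mul_mem_right _ _ ha)

/-- `F ∈ (u₂,u₁)²` (the NOEXIT centre at even stages is equimultiple: `ord_P F = 2 = ord t²`). [folklore] -/
theorem F_mem_sq_21 : (X 1 ^ 4 * X 3 + X 0 ^ 4 * X 2 ^ 3 : MvPolynomial (Fin 4) R) ∈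
    (Ideal.span {(X 2 : MvPolynomial (Fin 4) R), X 1}) ^ 2 := by
  obtain ⟨h2, h1⟩ := memI (a := (X 2 : MvPolynomial (Fin 4) R)) (b := X 1)
  refine Ideal.add_mem _ ?_ ?_
  · have e : (X 1 ^ 4 * X 3 : MvPolynomial (Fin 4) R) = X 1 * (X 1 * (X 1 ^ 2 * X 3)) := by ring
    rw [e]; exact mul_mul_mem_sq h1
  · have e : (X 0 ^ 4 * X 2 ^ 3 : MvPolynomial (Fin 4) R) = X 2 * (X 2 * (X 0 ^ 4 * X 2)) := by ring
    rw [e]; exact mul_mul_mem_sq h2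

/-- `F ∈ (u₁,u₀)²` (the «big» plane is equimultiple too — a legal σ_top alternative at every even stage). [folklore] -/
theorem F_mem_sq_10 : (X 1 ^ 4 * X 3 + X 0 ^ 4 * X 2 ^ 3 : MvPolynomial (Fin 4) R) ∈
    (Ideal.span {(X 1 : MvPolynomial (Fin 4) R), X 0}) ^ 2 := by
  obtain ⟨h1, h0⟩ := memI (a := (X 1 : MvPolynomial (Fin 4) R)) (b := X 0)
  refine Ideal.add_mem _ ?_ ?_
  · have e : (X 1 ^ 4 * X 3 : MvPolynomial (Fin 4) R) = X 1 * (X 1 * (X 1 ^ 2 * X 3)) := by ring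
    rw [e]; exact mul_mul_mem_sq h1
  · have e : (X 0 ^ 4 * X 2 ^ 3 : MvPolynomial (Fin 4) R) = X 0 * (X 0 * (X 0 ^ 2 * X 2 ^ 3)) := by ring
    rw [e]; exact mul_mul_mem_sq h0

/-- `F′ ∈ (u₂,u₀)²` (the NOEXIT centre at odd stages is equimultiple). [folklore] -/
theorem F'_mem_sq_20 : (X 0 ^ 4 * X 2 + X 1 ^ 4 * X 2 ^ 2 * X 3 : MvPolynomial (Fin 4) R) ∈
    (Ideal.span {(X 2 : MvPolynomial (Fin 4) R), X 0}) ^ 2 := by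
  obtain ⟨h2, h0⟩ := memI (a := (X 2 : MvPolynomial (Fin 4) R)) (b := X 0)
  refine Ideal.add_mem _ ?_ ?_
  · have e : (X 0 ^ 4 * X 2 : MvPolynomial (Fin 4) R) = X 0 * (X 0 * (X 0 ^ 2 * X 2)) := by ring
    rw [e]; exact mul_mul_mem_sq h0
  · have e : (X 1 ^ 4 * X 2 ^ 2 * X 3 : MvPolynomial (Fin 4) R) = X 2 * (X 2 * (X 1 ^ 4 * X 3)) := by ring
    rw [e]; exact mul_mul_mem_sq h2

/-- `F′ ∈ (u₁,u₀)²`. [folklore] -/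
theorem F'_mem_sq_10 : (X 0 ^ 4 * X 2 + X 1 ^ 4 * X 2 ^ 2 * X 3 : MvPolynomial (Fin 4) R) ∈
    (Ideal.span {(X 1 : MvPolynomial (Fin 4) R), X 0}) ^ 2 := by
  obtain ⟨h1, h0⟩ := memI (a := (X 1 : MvPolynomial (Fin 4) R)) (b := X 0)
  refine Ideal.add_mem _ ?_ ?_
  · have e : (X 0 ^ 4 * X 2 : MvPolynomial (Fin 4) R) = X 0 * (X 0 * (X 0 ^ 2 * X 2)) := by ring
    rw [e]; exact mul_mul_mem_sq h0
  · have e : (X 1 ^ 4 * X 2 ^ 2 * X 3 : MvPolynomial (Fin 4) R) = X 1 * (X 1 * (X 1 ^ 2 * X 2 ^ 2 * X 3)) := by ring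
    rw [e]; exact mul_mul_mem_sq h1

end Permissible

/-! ## § 4 HIGH at every stage: cleaned order `5` -/

section Orders

variable {R : Type*} [CommRing R]

/-- every variable lies in `𝔪 = idealOfVars`. -/
private theorem Xmem (i : Fin 4) : (X i : MvPolynomial (Fin 4) R) ∈ idealOfVars (Fin 4) R :=
  Ideal.subset_span ⟨i, rfl⟩

/-- `u₁⁴u₃` as a `monomial`. -/
private theorem mono_F₁ : (X 1 ^ 4 * X 3 : MvPolynomial (Fin 4) R) = monomial (Finsupp.single 1 4 + Finsupp.single 3 1) 1 := by
  rw [X_pow_eq_monomial, X, monomial_mul, one_mul]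
/-- `u₀⁴u₂³` as a `monomial`. -/
private theorem mono_F₂ : (X 0 ^ 4 * X 2 ^ 3 : MvPolynomial (Fin 4) R) = monomial (Finsupp.single 0 4 + Finsupp.single 2 3) 1 := by
  rw [X_pow_eq_monomial, X_pow_eq_monomial, monomial_mul, one_mul]
/-- `u₀⁴u₂` as a `monomial`. -/
private theorem mono_F'₁ : (X 0 ^ 4 * X 2 : MvPolynomial (Fin 4) R) = monomial (Finsupp.single 0 4 + Finsupp.single 2 1) 1 := by
  rw [X_pow_eq_monomial, X, monomial_mul, one_mul]
/-- `u₁⁴u₂²u₃` as a `monomial`. -/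
private theorem mono_F'₂ : (X 1 ^ 4 * X 2 ^ 2 * X 3 : MvPolynomial (Fin 4) R) =
    monomial (Finsupp.single 1 4 + Finsupp.single 2 2 + Finsupp.single 3 1) 1 := by
  rw [X_pow_eq_monomial, X_pow_eq_monomial, X, monomial_mul, monomial_mul, one_mul, one_mul]

/-- coefficient of `u₁⁴u₃` in `F` is `1`. [folklore] -/
theorem coeff_F_lead : coeff (Finsupp.single 1 4 + Finsupp.single 3 1) (X 1 ^ 4 * X 3 + X 0 ^ 4 * X 2 ^ 3 : MvPolynomial (Fin 4) R) = 1 := by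
  have hne : (Finsupp.single 0 4 + Finsupp.single 2 3 : Fin 4 →₀ ℕ) ≠ Finsupp.single 1 4 + Finsupp.single 3 1 := by
    intro h; have h1 := congrArg (fun f => f 1) h; simp at h1
  rw [coeff_add, mono_F₁, mono_F₂, coeff_monomial, coeff_monomial, if_pos rfl, if_neg hne, add_zero]

/-- coefficient of `u₀⁴u₂` in `F′` is `1`. [folklore] -/
theorem coeff_F'_lead : coeff (Finsupp.single 0 4 + Finsupp.single 2 1) (X 0 ^ 4 * X 2 + X 1 ^ 4 * X 2 ^ 2 * X 3 : MvPolynomial (Fin 4) R) = 1 := by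
  have hne : (Finsupp.single 1 4 + Finsupp.single 2 2 + Finsupp.single 3 1 : Fin 4 →₀ ℕ) ≠ Finsupp.single 0 4 + Finsupp.single 2 1 := by
    intro h; have h1 := congrArg (fun f => f 0) h; simp at h1
  rw [coeff_add, mono_F'₁, mono_F'₂, coeff_monomial, coeff_monomial, if_pos rfl, if_neg hne, add_zero]

/-- `F ∈ 𝔪⁵` (both monomials have degree `≥ 5`). [folklore] -/
theorem F_mem_M_pow_five : (X 1 ^ 4 * X 3 + X 0 ^ 4 * X 2 ^ 3 : MvPolynomial (Fin 4) R) ∈ idealOfVars (Fin 4) R ^ 5 := by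
  refine Ideal.add_mem _ ?_ ?_
  · have h := Ideal.mul_mem_mul (Ideal.pow_mem_pow (Xmem (R := R) 1) 4) (Ideal.pow_mem_pow (Xmem (R := R) 3) 1)
    rw [← pow_add, pow_one] at h; exact h
  · have h := Ideal.mul_mem_mul (Ideal.pow_mem_pow (Xmem (R := R) 0) 4) (Ideal.pow_mem_pow (Xmem (R := R) 2) 3)
    rw [← pow_add] at h; exact Ideal.pow_le_pow_right (by norm_num) h

/-- `F ∉ 𝔪⁶` over a nontrivial ring: the degree-5 monomial `u₁⁴u₃` survives — cleaned order EXACTLY 5 (HIGH) at even stages. [folklore] -/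
theorem F_not_mem_M_pow_six [Nontrivial R] :
    (X 1 ^ 4 * X 3 + X 0 ^ 4 * X 2 ^ 3 : MvPolynomial (Fin 4) R) ∉ idealOfVars (Fin 4) R ^ 6 := by
  rw [mem_pow_idealOfVars_iff']
  intro h
  have h1 := h (Finsupp.single 1 4 + Finsupp.single 3 1) (by simp [Finsupp.degree_single])
  rw [coeff_F_lead] at h1
  exact one_ne_zero h1

/-- `F′ ∈ 𝔪⁵`. [folklore] -/
theorem F'_mem_M_pow_five : (X 0 ^ 4 * X 2 + X 1 ^ 4 * X 2 ^ 2 * X 3 : MvPolynomial (Fin 4) R) ∈ idealOfVars (Fin 4) R ^ 5 := by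
  refine Ideal.add_mem _ ?_ ?_
  · have h := Ideal.mul_mem_mul (Ideal.pow_mem_pow (Xmem (R := R) 0) 4) (Ideal.pow_mem_pow (Xmem (R := R) 2) 1)
    rw [← pow_add, pow_one] at h; exact h
  · have h := Ideal.mul_mem_mul (Ideal.mul_mem_mul (Ideal.pow_mem_pow (Xmem (R := R) 1) 4) (Ideal.pow_mem_pow (Xmem (R := R) 2) 2))
      (Ideal.pow_mem_pow (Xmem (R := R) 3) 1)
    rw [← pow_add, ← pow_add, pow_one] at h; exact Ideal.pow_le_pow_right (by norm_num) h

/-- `F′ ∉ 𝔪⁶` (the degree-5 monomial `u₀⁴u₂`): cleaned order exactly 5 at odd stages. [folklore] -/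
theorem F'_not_mem_M_pow_six [Nontrivial R] :
    (X 0 ^ 4 * X 2 + X 1 ^ 4 * X 2 ^ 2 * X 3 : MvPolynomial (Fin 4) R) ∉ idealOfVars (Fin 4) R ^ 6 := by
  rw [mem_pow_idealOfVars_iff']
  intro h
  have h1 := h (Finsupp.single 0 4 + Finsupp.single 2 1) (by simp [Finsupp.degree_single])
  rw [coeff_F'_lead] at h1
  exact one_ne_zero h1

end Orders

/-! ## § 5 Boundary parity of the fresh exceptional divisor `V(u₂)` -/

section Parity

variable {R : Type*} [CommRing R]

/-- `u₂ ∣ F′`: after the even step the fresh `E = V(u₂)` carries the radicand with multiplicity `≥ 1`. [folklore] -/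
theorem X2_dvd_F' : (X 2 : MvPolynomial (Fin 4) R) ∣ X 0 ^ 4 * X 2 + X 1 ^ 4 * X 2 ^ 2 * X 3 :=
  ⟨X 0 ^ 4 + X 1 ^ 4 * X 2 * X 3, by ring⟩

/-- `¬ u₂² ∣ F′` over a nontrivial ring: the multiplicity of `E = V(u₂)` in `F′` is EXACTLY 1 (ODD) — with `F′` reduced this is the
parity `r̄_E = 1` of PREREG-FB, so the residual order at odd stages reads `d = 5 − 1 = 4`. [folklore] -/
theorem not_X2_sq_dvd_F' [Nontrivial R] : ¬ (X 2 ^ 2 : MvPolynomial (Fin 4) R) ∣ X 0 ^ 4 * X 2 + X 1 ^ 4 * X 2 ^ 2 * X 3 := by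
  rintro ⟨q, hq⟩
  have h := congr_arg (coeff (Finsupp.single 0 4 + Finsupp.single 2 1)) hq
  have rhs : coeff (Finsupp.single 0 4 + Finsupp.single 2 1) (X 2 ^ 2 * q : MvPolynomial (Fin 4) R) = 0 := by
    rw [X_pow_eq_monomial, coeff_monomial_mul', if_neg]
    intro hle
    have h2 := hle 2
    simp at h2
  rw [coeff_F'_lead, rhs] at h
  exact one_ne_zero h

/-- `¬ u₂ ∣ F` over a nontrivial ring: at even stages the divisor `V(u₂)` has multiplicity `0` in `F` (the monomial `u₁⁴u₃`), so no
boundary component through the centre is odd and `d = 5`. [folklore] -/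
theorem not_X2_dvd_F [Nontrivial R] : ¬ (X 2 : MvPolynomial (Fin 4) R) ∣ X 1 ^ 4 * X 3 + X 0 ^ 4 * X 2 ^ 3 := by
  rintro ⟨q, hq⟩
  have h := congr_arg (coeff (Finsupp.single 1 4 + Finsupp.single 3 1)) hq
  have rhs : coeff (Finsupp.single 1 4 + Finsupp.single 3 1) (X 2 * q : MvPolynomial (Fin 4) R) = 0 := by
    rw [coeff_X_mul', if_neg]
    simp [Finsupp.mem_support_iff]
  rw [coeff_F_lead, rhs] at h
  exact one_ne_zero h

end Parity

/-! ## § 6 The value bookkeeping that fixes the chart for ever -/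

/-- Lexicographic bookkeeping of the run's values: at every stage the exceptional parameter is `u₂` because `v(u₂) = (0,2)` is
lex-smaller than `v(u₁) = (a, b)` resp. `v(u₀) = (a′, b′)` whose FIRST coordinates `a = 7` (V-BA) / `5` (V-AC), `a′ = 2` are positive
and never change (`v(u₁′) = v(u₁) − v(u₂) = (a, b − 2)`): `(0, 2) < (a, c)` in the lex order for every `c` as soon as `0 < a`.
[folklore] -/
theorem lex_small_lt_big (a b : ℤ) (ha : 0 < a) : toLex ((0 : ℤ), (2 : ℤ)) < toLex (a, b) :=
  Prod.Lex.toLex_lt_toLex.2 (Or.inl ha)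

end Summit.ResolutionOfSingularities.ResolutionOfSingularities.Theorems.K41dNoExitSpecimen
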